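import Summits.ABC.StewartYu.GenThreeFrameSpecOdd
import HarnessLib

/-!
# Cell abc-stewartyu, Gen-3 frame at odd `p` (crux `Y07Odd`, stmt-ABC-19658): the BASE RANKS `n = 0, 1`
# of the per-rank dichotomy, and the engine text from the frame at ranks `≥ 2`

`Summits/ABC/StewartYu/GenThreeBaseOdd.lean` — cell `abc-stewartyu` (HOME `run/shared/lean/pub/abc-stewartyu/`),
route `PadicPrimesKummerThird`, seat p4 (g3), engine-support seat; the odd-`p` TWIN of p3-g5's
`Summits/ABC/StewartYu/GenThreeBaseTwo.lean`.  Theorems only.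

Matveev's induction (`GenThreeInductionOdd.core_of_dichotomy`) needs the dichotomy `DichotomyOdd C p n` at
EVERY rank.  Rank `0` is vacuous (`b ≠ 0` is impossible on `Fin 0`).  Rank `1` is ONE `p`-adic logarithm
of a rational `p`-adic unit `θ ∉ {0, 1, −1}` (independence) and needs no auxiliary construction: the tree's
elementary one-logarithm estimate at odd `p`
`Literature.NumberTheory.DiophantineGeometry.Dioph.padicValRat_zpow_sub_one_mul_log_le'`
(lifting the exponent above the order of `θ̄` in `𝔽ₚˣ`, `≤ p − 1`) gives
`ord_p(θᵐ − 1)·log p ≤ 2(p − 1)·h(θ) + log|m| ≤ 2(p−1)·A + W ≤ C(1)·(p/log p)·A·(W + log p + log 2Amax)`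
as soon as `2 ≤ C 1` — `dichotomyOdd_one`.  Consequently the analytic frame is owed only at ranks `n ≥ 2`
(where the `b`-eliminated directions exist): `engineOdd_of_frame_two_le`.

WHAT THIS IS NOT: no analytic content; no crux moves.

References: K. Yu, Compositio Math. 74 (1990), §1.1; Yu. V. Nesterenko, LNM 1819 (2003), Thm 2.1 (the case
`n = 1`); K. Yu, Forum Math. 19 (2007), Main Theorem (`K = ℚ`).
-/

noncomputable section

open Finset
open Literature.NumberTheory.Transcendental

namespace Summit.ABC.StewartYu.GenThreeBaseOdd

open Summit.ABC.StewartYu.GenThreeInductionOdd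
open Summit.ABC.StewartYu.GenThreeFrameSpecOdd

variable {p : ℕ}

/-! ### The base ranks -/

/-- Rank `0` of the odd-`p` dichotomy is vacuous (`b ≠ 0` is impossible on `Fin 0`). [folklore] -/
theorem dichotomyOdd_zero (C : ℕ → ℝ) (p : ℕ) : DichotomyOdd C p 0 := by
  intro α b V Vmax W _ _ _ _ _ _ hb _ _
  exact absurd (funext fun j => Fin.elim0 j) hb

/-- `p / log p ≥ 1` for a prime `p` (indeed for every real `x > 0`, `log x ≤ x − 1 < x`). [folklore] -/
theorem one_le_div_log (hp : p.Prime) : 1 ≤ (p : ℝ) / Real.log p := by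
  have hp1 : (1 : ℝ) < p := by exact_mod_cast hp.one_lt
  have hlogpos : 0 < Real.log p := Real.log_pos hp1
  rw [le_div_iff₀ hlogpos, one_mul]
  have h := Real.log_le_sub_one_of_pos (by linarith : (0 : ℝ) < p)
  linarith

/-- **Rank `1` of the odd-`p` dichotomy by the elementary one-logarithm estimate**: for `2 ≤ C 1`,
`ord_p(θᵐ − 1)·log p ≤ 2(p−1)·h(θ) + log|m| ≤ C(1)·(p/log p)·A·(W + log p + log 2Amax)`.
[cite: Yu1990, §1.1; shape only] -/
theorem dichotomyOdd_one [Fact p.Prime] (hp2 : p ≠ 2) {C : ℕ → ℝ} (hC : 2 ≤ C 1) :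
    DichotomyOdd C p 1 := by
  have hp : p.Prime := Fact.out
  intro α b V Vmax W hα hind _hK hV hV1 hVmax hb hW hW1
  left
  have hb0 : b 0 ≠ 0 := by
    intro h0; apply hb; funext j
    have : j = 0 := Subsingleton.elim _ _
    rw [this, h0]; rfl
  obtain ⟨hθ0, hθv⟩ := hα 0
  -- `θ ≠ ±1` from multiplicative independence
  have hθ1 : α 0 ≠ 1 := by
    intro h1
    have h := hind (fun _ => 1) (by rw [Fin.prod_univ_one, h1, one_zpow])
    exact one_ne_zero (congrFun h 0)
  have hθm1 : α 0 ≠ -1 := by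
    intro h1
    have h := hind (fun _ => 2) (by
      rw [Fin.prod_univ_one, h1]; norm_num)
    have h2 := congrFun h 0
    norm_num at h2
  -- the product over `Fin 1`
  have hprod : ∏ j : Fin 1, α j ^ b j = α 0 ^ b 0 := by rw [Fin.prod_univ_one]
  have hprodV : ∏ j : Fin 1, V j = V 0 := by rw [Fin.prod_univ_one]
  rw [hprod, hprodV]
  have hest := Literature.NumberTheory.DiophantineGeometry.Dioph.padicValRat_zpow_sub_one_mul_log_le'
    hp hp2 hθ0 hθv hθ1 hθm1 hb0
  -- `log |b 0| ≤ W`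
  have hlogb : Real.log ((b 0).natAbs : ℝ) ≤ W := by
    have hcast : ((b 0).natAbs : ℝ) = |(b 0 : ℝ)| := by
      rw [Nat.cast_natAbs, Int.cast_abs]
    have hpos : (0 : ℝ) < |(b 0 : ℝ)| := abs_pos.mpr (by exact_mod_cast hb0)
    rw [hcast]
    exact (Real.log_le_log hpos (le_max_right 3 _)).trans (hW 0)
  -- numerics
  have hp1 : (1 : ℝ) < p := by exact_mod_cast hp.one_lt
  have hlogp : 0 < Real.log p := Real.log_pos hp1
  have hq1 : 1 ≤ (p : ℝ) / Real.log p := one_le_div_log hp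
  have hA1 := hV1 0
  have hA0 : 0 ≤ V 0 := by linarith
  have hAmax : 1 ≤ Vmax := hA1.trans (hVmax 0)
  have hl2V : 0 ≤ Real.log (2 * Vmax) := Real.log_nonneg (by linarith)
  have hh : Height.logHeight₁ (α 0) ≤ V 0 := hV 0
  -- `2(p−1)h + log|b| ≤ 2(p−1)V + W ≤ C 1·(p/log p)·V·(W + log p + log 2Vmax)`
  have hstep1 : (padicValRat p (α 0 ^ b 0 - 1) : ℝ) * Real.log p ≤ 2 * ((p : ℝ) - 1) * V 0 + W := by
    have := mul_le_mul_of_nonneg_left hh (by linarith : (0 : ℝ) ≤ 2 * ((p : ℝ) - 1))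
    linarith [hest, hlogb]
  have hstep2 : 2 * ((p : ℝ) - 1) * V 0 + W ≤
      C 1 * ((p : ℝ) / Real.log p) * V 0 * (W + Real.log p + Real.log (2 * Vmax)) := by
    -- `(p/log p)·V·log p = p·V` and `(p/log p)·V·W ≥ W`
    have e1 : (p : ℝ) / Real.log p * V 0 * Real.log p = (p : ℝ) * V 0 := by
      field_simp
    have hVW : W ≤ (p : ℝ) / Real.log p * V 0 * W := by
      have h1 : 1 ≤ (p : ℝ) / Real.log p * V 0 := by nlinarith
      nlinarith
    have hmain : 2 * ((p : ℝ) - 1) * V 0 + W ≤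
        2 * ((p : ℝ) / Real.log p * V 0 * (W + Real.log p + Real.log (2 * Vmax))) := by
      have hexp : (p : ℝ) / Real.log p * V 0 * (W + Real.log p + Real.log (2 * Vmax)) =
          (p : ℝ) / Real.log p * V 0 * W + (p : ℝ) * V 0 +
            (p : ℝ) / Real.log p * V 0 * Real.log (2 * Vmax) := by
        rw [← e1]; ring
      rw [hexp]
      have h3 : 0 ≤ (p : ℝ) / Real.log p * V 0 * Real.log (2 * Vmax) := by positivity
      nlinarith
    have hC2 : 2 * ((p : ℝ) / Real.log p * V 0 * (W + Real.log p + Real.log (2 * Vmax))) ≤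
        C 1 * ((p : ℝ) / Real.log p) * V 0 * (W + Real.log p + Real.log (2 * Vmax)) := by
      have h0 : 0 ≤ (p : ℝ) / Real.log p * V 0 * (W + Real.log p + Real.log (2 * Vmax)) := by
        have : 0 ≤ W + Real.log p + Real.log (2 * Vmax) := by linarith
        positivity
      calc 2 * ((p : ℝ) / Real.log p * V 0 * (W + Real.log p + Real.log (2 * Vmax)))
          ≤ C 1 * ((p : ℝ) / Real.log p * V 0 * (W + Real.log p + Real.log (2 * Vmax))) :=
            mul_le_mul_of_nonneg_right hC h0
        _ = C 1 * ((p : ℝ) / Real.log p) * V 0 * (W + Real.log p + Real.log (2 * Vmax)) := by ring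
    exact hmain.trans hC2
  exact hstep1.trans hstep2

/-! ### The engine text from the frame at ranks `≥ 2` -/

/-- **The frozen `GenThreeEngineOdd` text from the zero estimate, an admissible `C ≤ c₁ⁿ` with
`2 ≤ C 1`, and the odd-`p` analytic frame at every rank `n ≥ 2` and every odd prime.**  (Ranks `0, 1` are
`dichotomyOdd_zero`, `dichotomyOdd_one`.) [cite: Yu2007, Main Thm (K = ℚ); shape only] -/
theorem engineOdd_of_frame_two_le {C : ℕ → ℝ} {c₁ : ℝ} (hc₁ : 1 ≤ c₁)
    (hC : ∀ m, 0 ≤ C m ∧ C m ≤ c₁ ^ m) (hC1 : 2 ≤ C 1)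
    (hF : Nesterenko2003_prop51 → ∀ p : ℕ, p.Prime → p ≠ 2 → ∀ n, 2 ≤ n → FrameOdd C p n)
    (hZ : Nesterenko2003_prop51) :
    ∃ (C : ℕ → ℝ) (c₁ : ℝ), 1 ≤ c₁ ∧ (∀ m, 0 ≤ C m ∧ C m ≤ c₁ ^ m) ∧
      ∀ (p : ℕ), p.Prime → p ≠ 2 → ∀ (m : ℕ) (α : Fin m → ℚ) (b : Fin m → ℤ) (V : Fin m → ℝ)
        (Vmax W : ℝ),
        (∀ j, α j ≠ 0 ∧ padicValRat p (α j) = 0) →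
        (∀ μ : Fin m → ℤ, ∏ j, α j ^ μ j = 1 → μ = 0) →
        (∀ T : Finset (Fin m), T.Nonempty → ¬ IsSquare (∏ j ∈ T, α j) ∧ ¬ IsSquare (-∏ j ∈ T, α j)) →
        (∀ j, Height.logHeight₁ (α j) ≤ V j) → (∀ j, Real.log 2 ≤ V j) → (∀ j, V j ≤ Vmax) →
        b ≠ 0 → (∀ j, Real.log (max 3 (|b j| : ℝ)) ≤ W) →
        (padicValRat p (∏ j, α j ^ b j - 1) : ℝ) * Real.log p ≤
          C m * ((p : ℝ) / Real.log p) * (∏ j, V j) * (W + Real.log p + Real.log (2 * Vmax)) := by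
  refine engineOdd_of_dichotomy hc₁ hC (fun hZ' p hp hp2 n => ?_) hZ
  haveI : Fact p.Prime := ⟨hp⟩
  rcases Nat.lt_or_ge n 2 with hn | hn
  · interval_cases n
    · exact dichotomyOdd_zero C p
    · exact dichotomyOdd_one hp2 hC1
  · exact dichotomyOdd_of_frame hZ' (fun r => (hC r).1) (hF hZ' p hp hp2 n hn)

end Summit.ABC.StewartYu.GenThreeBaseOdd

end
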